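import Summits.BirchSwinnertonDyer.Rank1Residual.X11b.KolyvaginShaFiniteOfLeafInputs
import Summits.BirchSwinnertonDyer.Rank1Residual.X11b.KolyvaginHGZOfKodairaNeron
import HarnessLib

/-!
# X11b (team N8/O2): the Kolyvagin finiteness telescope with the label [GZ86 III (3.1)] DISCHARGED
# on the Kodaira–Néron sub-class (KN∀) — seven cite-only inputs instead of eight

HONEST FRAMING (cell `b2b-bsdres`, run/shared/lean/b2b/bsd-rank1-residual/, verbatim in every
file): the goal of the cell is to DELETE the COMBINATION-SHAPED residual classes of the
Birch–Swinnerton-Dyer formula for ALL analytic-rank `≤ 1` elliptic curves over `ℚ` — "full BSD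
formula for every rank `≤ 1` curve in class `C`" assembled STRICTLY from published theorems — so
that the rank-`≤ 1` remainder becomes exactly the CONSTRUCTION-SHAPED classes, which are TYPED
(missing-input `Prop`s), NOT attempted. This is not "finishing BSD". Team N8/O2 = `x11b3`, seat
`b2b-bsdres-x11b3-p2` (GEN 33). THEOREMS ONLY; `K : Type`; plumbing — ONE composition; nothing
booked; no mark / label / count / tier moves.

## What

`KolyvaginAssembly.sha_primary_finite_of_leafInputs_of_poitouTate` (x11b3-p2 GEN 13, p307212)
reads `Kolyvagin1990_sha_primary_finite N W K` ⟸ EXACTLY {`hPT`, `hexc`, `hrec`, `hCM`, `h53`,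
`hGZ`, `hγ`, `hK1`} + `hN`.  Here the binder `hGZ` ([GZ86, III (3.1)] as Gross 1991 p. 245 uses
it) is SUPPLIED by `KolyvaginHloc.hGZ_of_kodairaNeron` (Kodaira–Néron over `K_v^nr`, Silverman
*AEC* VII.6.1, NO Heegner input) on the sub-class

  (KN∀) no odd prime `p` with `ρ̄_{E,p}` onto divides `ord_v(Δ_min(E/K))` at a multiplicative
        place `v`, and, if `ρ̄_{E,3}` is onto, no additive place of `E/K` has Kodaira type IV / IV*,

so that on (KN∀): `Kolyvagin1990_sha_primary_finite N W K` ⟸ EXACTLY {`hPT`, `hexc`, `hrec`,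
`hCM`, `h53`, `hγ`, `hK1`} + `hN` + (KN∀) — SEVEN cite-only inputs, the eighth a tree theorem.
READING (EVIDENCE wording): '[GZ86 III (3.1)] ✓ (tree) on (KN∀); needed only at `p ∣ 2·∏ ord_v Δ_min`
and at 3 when a IV / IV* place is present; nothing else discharged; node / v4.3 / v4.5 / TRUE-OPEN / corner
UNCHANGED; no mark'.

* **`KolyvaginAssembly.sha_primary_finite_of_leafInputs_of_poitouTate_of_kodairaNeron`** — the
  composition; binders other than `hGZ` are p307212's VERBATIM.

References: [GrossLMS1991] Thm. 1.3 (2), Prop. 6.2 (1); [McCallumLMS1991] §1, Prop. 2.2;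
[GrossZagier1986] III (3.1); [SilvermanAEC2009] Thm. VII.6.1.

presearch: composition of two tree theorems; `lean search 'of_poitouTate_of_kodairaNeron'` → no
matches (INTENT-grep).
-/

noncomputable section

open scoped Classical
open WeierstrassCurve Field NumberField IsDedekindDomain
open Literature.NumberTheory.EllipticCurves Literature.NumberTheory.GaloisRepresentations
open Literature.NumberTheory.EllipticCurves.RingClassField
open Literature.NumberTheory.EllipticCurves.ModularForms
open Literature.NumberTheory.DiophantineGeometry Literature.NumberTheory.DiophantineGeometry.TateAlgorithm

namespace Summit.BirchSwinnertonDyer.Rank1Residual.X11b.KolyvaginAssembly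

-- `K : Type`: the tree's ring-class class field theory is universe `0`.
variable {K : Type} [Field K] [NumberField K] {N : ℕ} {W : WeierstrassCurve ℚ}

/-- **`Ш(E/K)[p^∞]` finite for every `p` from SEVEN cite-only inputs on the Kodaira–Néron sub-class
(KN∀)**: `sha_primary_finite_of_leafInputs_of_poitouTate` with its binder `hGZ` ([GZ86, III (3.1)])
SUPPLIED by `KolyvaginHloc.hGZ_of_kodairaNeron` under `hKNm` (no odd surjective prime divides
`ord_v(Δ_min(E/K))` at a multiplicative `v`) and `hKNa` (if `ρ̄_{E,3}` is onto, no additive place of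
type IV / IV*).
CONDITIONAL on EXACTLY {`hPT` (named fact), `hexc`, `hrec`, `hCM`, `h53`, `hγ`, `hK1`} + `hN` +
(KN∀); cite-only, NOT discharged except `hGZ`; nothing booked; no mark.
[cite: GrossLMS1991, Thm. 1.3 (2), Prop. 6.2 (1)] [cite: SilvermanAEC2009, Thm. VII.6.1] -/
theorem sha_primary_finite_of_leafInputs_of_poitouTate_of_kodairaNeron [NeZero N]
    [W.IsGloballyMinimal]
    (hPT : Literature.NumberTheory.GaloisCohomology.poitouTate_sum_localTatePairing_eq_zero K)
    (hexc : Kolyvagin1990_thmA_of_hasCM_or_discr N W K)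
    (hN : ∀ [W.IsElliptic], N = W.conductorNorm ℤ)
    (hrec : heegnerPointOfConductor_one_galoisConj N W K)
    (hCM : ∀ [W.IsElliptic] (_hK : IsImaginaryQuadratic K) (_hH : SatisfiesHeegnerHypothesis N K)
      (Dt : ModularParametrizationData W N) (β : ℤ) (ι : K →+* ℂ),
      (4 * N : ℤ) ∣ β ^ 2 - NumberField.discr K →
      ∀ {p M : ℕ}, p.Prime → 1 ≤ M → ∀ (m : ℕ), Squarefree m →
      (∀ q ∈ m.primeFactors, IsKolyvaginPrime N W K p q ∧ FrobEqFrobInfty W K (p ^ M) q) →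
      ∃ y : (W.baseChange (ringClassField K ι m)).toAffine.Point,
        WeierstrassCurve.Affine.Point.map (W' := W) (ringClassField K ι m).subtype.toRatAlgHom y =
          heegnerPointComplexOfConductor Dt (NumberField.discr K) β m)
    (h53 : ∀ [W.IsElliptic] (_hK : IsImaginaryQuadratic K) (_hH : SatisfiesHeegnerHypothesis N K)
      (Dt : ModularParametrizationData W N) (β : ℤ) (ι : K →+* ℂ) {p M : ℕ} (_hp : p.Prime)
      (_hM : 1 ≤ M) {n : ℕ} (_hn : Squarefree n)
      (_hKol : ∀ q ∈ n.primeFactors, IsKolyvaginPrime N W K p q ∧ FrobEqFrobInfty W K (p ^ M) q)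
      (d : (m : ℕ) → m ∣ n → KolyvaginHeegnerData Dt β ι m) (m : ℕ) (hm : m ∣ n)
      (τm : ringClassField K ι m ≃ₐ[ℚ] ringClassField K ι m),
      (∀ x : ringClassField K ι m, ((τm x : ringClassField K ι m) : ℂ) = starRingEnd ℂ x) →
      ∃ σ' ∈ ringClassGal ι m, IsOfFinAddOrder
        (pointGalHom W (ringClassField K ι m) τm (d m hm).y -
          (-W.rootNumber) • pointGalHom W (ringClassField K ι m) σ' (d m hm).y))
    (hKNm : ∀ [W.IsElliptic] (v : HeightOneSpectrum (𝓞 K)),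
      (W.baseChange K).HasMultiplicativeReductionAt v → ∀ (p : ℕ), p.Prime → p ≠ 2 →
        W.HasSurjectiveModNGaloisRep p → ¬ p ∣ (W.baseChange K).ordMinimalDiscriminant v)
    (hKNa : ∀ [W.IsElliptic] (v : HeightOneSpectrum (𝓞 K)),
      (W.baseChange K).HasAdditiveReductionAt v → W.HasSurjectiveModNGaloisRep 3 →
        (W.baseChange K).kodairaSymbolAt v ≠ KodairaSymbol.IV ∧
          (W.baseChange K).kodairaSymbolAt v ≠ KodairaSymbol.IVstar)
    (hγ : ∀ [W.IsElliptic] (_hK : IsImaginaryQuadratic K) (_hH : SatisfiesHeegnerHypothesis N K)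
      (Dt : ModularParametrizationData W N) (β : ℤ) (ι : K →+* ℂ) {p M : ℕ} (_hp : p.Prime)
      (_hM : 1 ≤ M) {n : ℕ} (_hn : Squarefree n)
      (_hKol : ∀ q ∈ n.primeFactors, IsKolyvaginPrime N W K p q ∧ FrobEqFrobInfty W K (p ^ M) q)
      (d : (m : ℕ) → m ∣ n → KolyvaginHeegnerData Dt β ι m)
      (m : ℕ) (hm : m ∣ n) (ℓ : ℕ) (hℓ : ℓ ∈ m.primeFactors) [Fact ℓ.Prime]
      (hΔ : ¬ (ℓ : ℤ) ∣ minimalDiscriminantInt W) (φ₀ : absoluteGaloisGroup (ZMod ℓ)),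
      (∀ x : AlgebraicClosure (ZMod ℓ), φ₀ • x = x ^ ℓ) →
      ∀ (hle : ringClassField K ι (m / ℓ) ≤ ringClassField K ι m)
        (γ : ringClassField K ι m ≃ₐ[ℚ] ringClassField K ι m), γ ∈ ringClassGal ι m →
        geomReduction hΔ ((RatClosure.pointsEquiv (K := K) W).symm
            ((d m hm).toGeomPoints (pointGalHom W (ringClassField K ι m) γ (d m hm).y))) =
          φ₀ • geomReduction hΔ ((RatClosure.pointsEquiv (K := K) W).symm
            ((d m hm).toGeomPoints (pointGalHom W (ringClassField K ι m) γ
              (WeierstrassCurve.Affine.Point.map (W' := W)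
                ((RingClassField.inclusion ι hle).restrictScalars ℚ)
                (d (m / ℓ)
                  ((Nat.div_dvd_of_dvd (Nat.dvd_of_mem_primeFactors hℓ)).trans hm)).y)))))
    (hK1 : ∀ [W.IsElliptic] (_hE : ¬ W.HasCM)
      (_hD : NumberField.discr K ≠ -3 ∧ NumberField.discr K ≠ -4) (_hK : IsImaginaryQuadratic K)
      (_hH : SatisfiesHeegnerHypothesis N K) {P : (W.baseChange K).toAffine.Point}
      (_hP : IsHeegnerPoint N W K P) (_hnt : ¬ IsOfFinAddOrder P) (p : ℕ) (_hp : p.Prime),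
      (p = 2 ∨ ¬ W.HasSurjectiveModNGaloisRep p) →
      Set.Finite {c : (W.baseChange K).sha | ∃ j : ℕ, p ^ j • c = 0}) :
    Kolyvagin1990_sha_primary_finite N W K :=
  sha_primary_finite_of_leafInputs_of_poitouTate hPT hexc hN hrec hCM h53
    (@fun _ hK _ Dt _ ι p _ hp hp2 hρ _ _ hn hKol d ↦
      KolyvaginHloc.hGZ_of_kodairaNeron hK ι Dt hp hp2 hn hKol d
        (fun v hv ↦ hKNm v hv p hp hp2 hρ) (fun v hv ↦ by
          by_cases hp3 : p = 3
          · subst hp3; exact Or.inr (hKNa v hv hρ)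
          · exact Or.inl hp3))
    hγ hK1

end Summit.BirchSwinnertonDyer.Rank1Residual.X11b.KolyvaginAssembly

end
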